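import Literature.MathematicalPhysics.QuantumLattice.FinDimSpectrumSectorGibbsLimit
import Summits.HubbardSuperconductivity.HubbardSuperconductivity.Theorems.TwTipContinuation.Negative.SeededChords
import Literature.MathematicalPhysics.QuantumLattice.DWaveSourceProofs
import Literature.MathematicalPhysics.QuantumLattice.LiebFluxPhaseProofs

/-!
# Route `ThermalWedge` — sector entropy sandwich and the probabilistic normal form of the
ensemble defect, for the ANCHOR `TwSeededRung` (stmt-HubbardSuperconductivity-1699)

Route-file-free helper module (imports no `Theses` file of this route). The master inequality
`tw_rung_master` (`ThermalWedgeTwSeededRungMaster.lean`) reduces the anchor to a lower bound on the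
sourced-pressure gain (crux `TwSourcedCondensation`) and an UPPER bound on the canonical /
grand-canonical DEFECT of the seeded model,
`A_L(β,μ,g;V) := E_V(U,g)/L² + p_L(β,μ,U,g) − μN_V/L²` (`V = szSector N_V 0`).
Here the defect is put in its thermal normal form:

* `re_trace_projMatrix_mul_gibbsWeight_le` (generic finite-dimensional fact): for Hermitian `H`,
  an `H`-invariant subspace `K` and `β ≥ 0`, `Re tr (P_K e^{-βH}) ≤ dim K · e^{-β·minEnergyOn H K}`
  — the SECTOR version of `Z ≤ dim · e^{-βE₀}` (`partitionFn_le_card_mul_exp`); and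
  `re_trace_projMatrix_mul_gibbsWeight_pos`: `0 < Re tr (P_K e^{-βH})` for `K ≠ ⊥`;
* `seeded_sectorWeight_le`: for the seeded grand-canonical torus Hamiltonian
  `K_L(μ,g) = hubbardTorusWith 2 L 1 U μ − (g/L²)P_L` and `V = szSector 2n 0` (`n ≤ L²`),
  `Re tr (P_V e^{-βK}) ≤ dim V · exp(−β (E_V(U,g) − μ·2n))`;
* `seeded_defect_le_log_sectorWeight`: hence the PROBABILISTIC NORMAL FORM of the defect,
  `β L² · A_L ≤ log dim V + log (Re Z / Re tr (P_V e^{-βK}))`: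
  the defect is at most `(log dim V)/(βL²) ≤ log 4/β` plus `(βL²)⁻¹ log (1 / w_V)`, where
  `w_V = tr (P_V e^{-βK}) / Z ∈ (0,1]` is the Gibbs WEIGHT OF THE SECTOR in the seeded
  grand-canonical state. A thermal proof of (any restatement of) `TwSeededEnsembleEquivalence`
  therefore amounts to `w_{V_L}(β, μ_L) ≥ e^{-βL²ε}` eventually — a large-deviation lower bound for
  the particle number / spin of the seeded Gibbs state at ONE temperature.
-/

namespace Summit.HubbardSuperconductivity.HubbardSuperconductivity.Theorems

open Literature.MathematicalPhysics.QuantumLattice Matrix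
open scoped Matrix.Norms.L2Operator ComplexOrder MatrixOrder InnerProductSpace

noncomputable section

section SectorTrace

variable {n : Type*} [Fintype n] [DecidableEq n]

/-- Diagonal expansion of the sector-restricted Gibbs weight in the eigenbasis of `H`:
`tr (P_K e^{-βH}) = Σᵢ Qᵢᵢ e^{-βλᵢ}` with `Q = U⋆ P_K U` positive semidefinite, `tr Q = dim K`, and
`Qᵢᵢ = 0` whenever `λᵢ < minEnergyOn H K` (for `H`-invariant `K`). [folklore] -/
private theorem trace_projMatrix_mul_gibbsWeight_eq_sum {H : Matrix n n ℂ} (hH : H.IsHermitian)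
    (K : Submodule ℂ (n → ℂ)) (hinv : ∀ v ∈ K, H *ᵥ v ∈ K) (β : ℝ) :
    ∃ q : n → ℝ, (∀ i, 0 ≤ q i) ∧ (∀ i, hH.eigenvalues i < H.minEnergyOn K → q i = 0) ∧
      ∑ i, q i = Module.finrank ℂ K ∧
      (projMatrix (K.map ((WithLp.linearEquiv 2 ℂ (n → ℂ)).symm :
          (n → ℂ) →ₗ[ℂ] EuclideanSpace ℂ n)) * gibbsWeight β H).trace =
        ∑ i, ((q i * Real.exp (-(β * hH.eigenvalues i)) : ℝ) : ℂ) := by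
  set e₀ : ℝ := H.minEnergyOn K with he₀
  set P := projMatrix (K.map ((WithLp.linearEquiv 2 ℂ (n → ℂ)).symm :
    (n → ℂ) →ₗ[ℂ] EuclideanSpace ℂ n)) with hP
  set U : Matrix n n ℂ := (hH.eigenvectorUnitary : Matrix n n ℂ) with hU
  have hUU : U * star U = 1 := Unitary.mul_star_self_of_mem hH.eigenvectorUnitary.prop
  have hPh : P.IsHermitian := projMatrix_isHermitian _
  have hPP : P * P = P := projMatrix_mul_self _
  -- the columns of `U` are eigenvectors; those below `e₀` are killed by `P`
  have hcol : ∀ j, H *ᵥ (fun i => U i j) = ((hH.eigenvalues j : ℝ) : ℂ) • (fun i => U i j) := by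
    intro j
    have h : (fun i => U i j) = ⇑(hH.eigenvectorBasis j) :=
      funext fun i => IsHermitian.eigenvectorUnitary_apply hH i j
    rw [h, hH.mulVec_eigenvectorBasis j, RCLike.real_smul_eq_coe_smul (K := ℂ)]
    rfl
  have hPU0 : ∀ i j, hH.eigenvalues j < e₀ → (P * U) i j = 0 := by
    intro i j hj
    have h := projMatrix_map_mulVec_eigenvector_below_eq_zero hH K hinv (hcol j) hj
    have h2 : (P * U) i j = (P *ᵥ fun k => U k j) i := by
      simp only [mul_apply, mulVec, dotProduct]
    rw [h2, hP, h, Pi.zero_apply]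
  -- the compressed projection `Q = U⋆ P U`
  set Q : Matrix n n ℂ := star U * (P * U) with hQ
  have hPpsd : P.PosSemidef := by
    have h := posSemidef_conjTranspose_mul_self P
    rwa [hPh.eq, hPP] at h
  have hQpsd : Q.PosSemidef := by
    have h := hPpsd.conjTranspose_mul_mul_same U
    rwa [← star_eq_conjTranspose, Matrix.mul_assoc] at h
  have hQii : ∀ i, 0 ≤ Q i i := fun i => hQpsd.diag_nonneg
  have hQii0 : ∀ i, hH.eigenvalues i < e₀ → Q i i = 0 := by
    intro i hi
    rw [hQ, mul_apply]
    exact Finset.sum_eq_zero fun k _ => by rw [hPU0 k i hi, mul_zero]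
  have htrQ : Q.trace = (Module.finrank ℂ K : ℂ) := by
    rw [hQ, trace_mul_comm, Matrix.mul_assoc, hUU, Matrix.mul_one]
    exact trace_projMatrix_map_eq_finrank K
  -- `e^{-βH}` in the eigenbasis
  have h2 : gibbsWeight β H =
      U * diagonal (fun i => (Real.exp (-(β * hH.eigenvalues i)) : ℂ)) * star U := by
    have hsmul : (-(β : ℂ) • H : Matrix n n ℂ) = (-β : ℝ) • H := by
      ext i j
      simp [Matrix.smul_apply, Complex.real_smul]
    have h1 : gibbsWeight β H = cfc (fun x : ℝ => Real.exp ((-β) • x)) H := by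
      rw [gibbsWeight, hsmul, cfc_comp_smul (-β) Real.exp H, CFC.real_exp_eq_normedSpace_exp]
    rw [h1, hH.cfc_eq, IsHermitian.cfc, Unitary.conjStarAlgAut_apply]
    simp only [smul_eq_mul, neg_mul]
    rfl
  -- the expansion
  refine ⟨fun i => (Q i i).re, fun i => (Complex.nonneg_iff.mp (hQii i)).1, fun i hi => ?_, ?_, ?_⟩
  · simp only [hQii0 i hi, Complex.zero_re]
  · have h := congrArg Complex.re htrQ
    rw [Matrix.trace, Complex.re_sum] at h
    simpa using h
  · have hre : ∀ i, ((Q i i).re : ℂ) = Q i i := fun i =>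
      Complex.ext (Complex.ofReal_re _)
        ((Complex.ofReal_im _).trans (Complex.nonneg_iff.mp (hQii i)).2)
    calc (P * gibbsWeight β H).trace
        = (P * U * diagonal (fun i => (Real.exp (-(β * hH.eigenvalues i)) : ℂ)) * star U).trace := by
          rw [h2, ← Matrix.mul_assoc, ← Matrix.mul_assoc]
      _ = (Q * diagonal (fun i => (Real.exp (-(β * hH.eigenvalues i)) : ℂ))).trace := by
          rw [trace_mul_comm, hQ, ← Matrix.mul_assoc, ← Matrix.mul_assoc]
      _ = ∑ i, Q i i * (Real.exp (-(β * hH.eigenvalues i)) : ℂ) := by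
          simp only [Matrix.trace, Matrix.diag, mul_diagonal]
      _ = ∑ i, ((((Q i i).re * Real.exp (-(β * hH.eigenvalues i)) : ℝ)) : ℂ) := by
          refine Finset.sum_congr rfl fun i _ => ?_
          rw [Complex.ofReal_mul, hre i]

/-- **Sector entropy sandwich (upper half).** For a Hermitian `H`, an `H`-invariant subspace `K`
and `β ≥ 0`: `Re tr (P_K e^{-βH}) ≤ dim K · e^{-β · minEnergyOn H K}` — the sector analogue of
`Z ≤ dim · e^{-βE₀}`. (Eigenbasis expansion `tr (P_K e^{-βH}) = Σᵢ Qᵢᵢ e^{-βλᵢ}`, `Q = U⋆P_KU ≥ 0`,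
`tr Q = dim K`, and `Qᵢᵢ = 0` for `λᵢ` below the sector energy.) Tasaki (2020) App. A;
Bratteli–Robinson II §5.3.1. [folklore] -/
theorem re_trace_projMatrix_mul_gibbsWeight_le {H : Matrix n n ℂ} (hH : H.IsHermitian)
    (K : Submodule ℂ (n → ℂ)) (hinv : ∀ v ∈ K, H *ᵥ v ∈ K) {β : ℝ} (hβ : 0 ≤ β) :
    ((projMatrix (K.map ((WithLp.linearEquiv 2 ℂ (n → ℂ)).symm :
        (n → ℂ) →ₗ[ℂ] EuclideanSpace ℂ n)) * gibbsWeight β H).trace).re ≤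
      (Module.finrank ℂ K : ℝ) * Real.exp (-(β * H.minEnergyOn K)) := by
  obtain ⟨q, hq0, hqz, hqs, htr⟩ := trace_projMatrix_mul_gibbsWeight_eq_sum hH K hinv β
  rw [htr, Complex.re_sum]
  simp only [Complex.ofReal_re]
  rw [← hqs, Finset.sum_mul]
  refine Finset.sum_le_sum fun i _ => ?_
  by_cases hi : hH.eigenvalues i < H.minEnergyOn K
  · rw [hqz i hi, zero_mul, zero_mul]
  · refine mul_le_mul_of_nonneg_left (Real.exp_le_exp.2 ?_) (hq0 i)
    have := not_lt.1 hi
    nlinarith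

/-- **Sector Gibbs weights are positive.** For a Hermitian `H`, an `H`-invariant subspace
`K ≠ ⊥` and any real `β`: `0 < Re tr (P_K e^{-βH})`. [folklore] -/
theorem re_trace_projMatrix_mul_gibbsWeight_pos {H : Matrix n n ℂ} (hH : H.IsHermitian)
    (K : Submodule ℂ (n → ℂ)) (hinv : ∀ v ∈ K, H *ᵥ v ∈ K) (hK : K ≠ ⊥) (β : ℝ) :
    0 < ((projMatrix (K.map ((WithLp.linearEquiv 2 ℂ (n → ℂ)).symm :
        (n → ℂ) →ₗ[ℂ] EuclideanSpace ℂ n)) * gibbsWeight β H).trace).re := by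
  obtain ⟨q, hq0, -, hqs, htr⟩ := trace_projMatrix_mul_gibbsWeight_eq_sum hH K hinv β
  rw [htr, Complex.re_sum]
  simp only [Complex.ofReal_re]
  have hpos : (0 : ℝ) < ∑ i, q i := by
    rw [hqs]
    exact_mod_cast Nat.cast_pos.mpr (Submodule.one_le_finrank_iff.mpr hK)
  have hlt : ∑ i ∈ (Finset.univ : Finset n), (fun _ => (0 : ℝ)) i <
      ∑ i ∈ (Finset.univ : Finset n), q i := by
    rw [Finset.sum_const_zero]
    exact hpos
  obtain ⟨i, -, hi⟩ := Finset.exists_lt_of_sum_lt hlt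
  refine Finset.sum_pos' (fun j _ => mul_nonneg (hq0 j) (Real.exp_pos _).le) ⟨i, Finset.mem_univ _, ?_⟩
  exact mul_pos hi (Real.exp_pos _)

end SectorTrace

section Seeded

open Summit.HubbardSuperconductivity.TwTipContinuation.Negative

variable (L : ℕ) [NeZero L]

/-- The seeded grand-canonical torus Hamiltonian `K_L(μ,g) = hubbardTorusWith 2 L 1 U μ − (g/L²)P_L`
is Hermitian. [folklore] -/
theorem tw_isHermitian_seededGC (U μ g : ℝ) :
    (hubbardTorusWith 2 L 1 U μ - ((g / (L : ℝ) ^ 2 : ℝ) : ℂ) •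
      ((pairField dWaveFormFactor L)ᴴ * pairField dWaveFormFactor L)).IsHermitian := by
  refine (isHermitian_hubbardTorusWith L 1 U μ).sub ?_
  exact (pairIntensity_posSemidef L).isHermitian.smul
    (by rw [isSelfAdjoint_iff, Complex.star_def, Complex.conj_ofReal])

/-- `K_L(μ,g)` conserves `N↑` and `N↓` (block diagonal in the sectors). [folklore] -/
theorem tw_preservesSectors_seededGC (U μ g : ℝ) :
    PreservesSectors (hubbardTorusWith 2 L 1 U μ - ((g / (L : ℝ) ^ 2 : ℝ) : ℂ) •
      ((pairField dWaveFormFactor L)ᴴ * pairField dWaveFormFactor L)) := by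
  have h1 := preservesSectors_seededH U g L
  have h2 : PreservesSectors (totalNumber : Matrix (Finset (Orb (FermionTorus 2 L)))
      (Finset (Orb (FermionTorus 2 L))) ℂ) :=
    PreservesSectors.sum fun x _ => PreservesSectors.sum fun σ _ =>
      LiebThm1.preservesSectors_numberOp x σ
  have h3 : hubbardTorusWith 2 L 1 U μ - ((g / (L : ℝ) ^ 2 : ℝ) : ℂ) •
      ((pairField dWaveFormFactor L)ᴴ * pairField dWaveFormFactor L) =
      (hubbardTorus 2 L 1 U - ((g / (L : ℝ) ^ 2 : ℝ) : ℂ) •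
        ((pairField dWaveFormFactor L)ᴴ * pairField dWaveFormFactor L)) +
        (-(μ : ℂ)) • totalNumber := by
    rw [hubbardTorusWith_eq, neg_smul]
    abel
  rw [h3]
  exact h1.add (h2.smul _)

/-- `K_L(μ,g)` leaves every sector `V = szSector 2n 0` invariant. [folklore] -/
theorem tw_seededGC_mulVec_mem_szSector (U μ g : ℝ) (n : ℕ) :
    ∀ v ∈ szSector (Λ := FermionTorus 2 L) (2 * n) (0 : ℝ),
      (hubbardTorusWith 2 L 1 U μ - ((g / (L : ℝ) ^ 2 : ℝ) : ℂ) •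
        ((pairField dWaveFormFactor L)ᴴ * pairField dWaveFormFactor L)) *ᵥ v ∈
        szSector (Λ := FermionTorus 2 L) (2 * n) (0 : ℝ) := by
  intro v hv
  rw [mem_szSector_two_mul_zero_iff] at hv ⊢
  exact (tw_preservesSectors_seededGC L U μ g).isInSector_mulVec hv

/-- On the sector `V = szSector 2n 0` the grand-canonical sector energy is the canonical one shifted
by `μ·2n`: `minEnergyOn H_L(U,g) V − μ·2n ≤ minEnergyOn K_L(μ,g) V` (`n ≤ L²`; in fact equality).
[folklore] -/
theorem tw_minEnergyOn_seededGC_ge (U μ g : ℝ) {n : ℕ} (hn : n ≤ Fintype.card (FermionTorus 2 L)) :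
    (hubbardTorus 2 L 1 U - ((g / (L : ℝ) ^ 2 : ℝ) : ℂ) •
        ((pairField dWaveFormFactor L)ᴴ * pairField dWaveFormFactor L)).minEnergyOn
          (szSector (Λ := FermionTorus 2 L) (2 * n) 0) - μ * ((2 * n : ℕ) : ℝ) ≤
      (hubbardTorusWith 2 L 1 U μ - ((g / (L : ℝ) ^ 2 : ℝ) : ℂ) •
        ((pairField dWaveFormFactor L)ᴴ * pairField dWaveFormFactor L)).minEnergyOn
          (szSector (Λ := FermionTorus 2 L) (2 * n) 0) := by
  obtain ⟨ψ₀, hψ₀, hgs₀⟩ := exists_unit_groundState U g L hn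
  have hHc : (hubbardTorus 2 L 1 U - ((g / (L : ℝ) ^ 2 : ℝ) : ℂ) •
      ((pairField dWaveFormFactor L)ᴴ * pairField dWaveFormFactor L)).IsHermitian :=
    seededH_isHermitian U g L
  refine le_csInf ⟨_, ψ₀, hgs₀.1, hψ₀, rfl⟩ ?_
  rintro E ⟨ψ, hψV, hψ1, rfl⟩
  have hN : IsNParticle (2 * n) ψ := ((mem_szSector_iff _ _ ψ).1 hψV).1
  -- `Re⟨ψ, Kψ⟩ = Re⟨ψ, H ψ⟩ − μ·2n`
  have hshift : (star ψ ⬝ᵥ (hubbardTorusWith 2 L 1 U μ - ((g / (L : ℝ) ^ 2 : ℝ) : ℂ) •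
      ((pairField dWaveFormFactor L)ᴴ * pairField dWaveFormFactor L)) *ᵥ ψ).re =
      (star ψ ⬝ᵥ (hubbardTorus 2 L 1 U - ((g / (L : ℝ) ^ 2 : ℝ) : ℂ) •
        ((pairField dWaveFormFactor L)ᴴ * pairField dWaveFormFactor L)) *ᵥ ψ).re -
        μ * ((2 * n : ℕ) : ℝ) := by
    have heq : hubbardTorusWith 2 L 1 U μ - ((g / (L : ℝ) ^ 2 : ℝ) : ℂ) •
        ((pairField dWaveFormFactor L)ᴴ * pairField dWaveFormFactor L) =
        (hubbardTorus 2 L 1 U - ((g / (L : ℝ) ^ 2 : ℝ) : ℂ) •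
          ((pairField dWaveFormFactor L)ᴴ * pairField dWaveFormFactor L)) -
          (μ : ℂ) • totalNumber := by
      rw [hubbardTorusWith_eq]; abel
    rw [heq, sub_mulVec, smul_mulVec, totalNumber_mulVec_of_isNParticle hN, smul_smul,
      dotProduct_sub, dotProduct_smul, hψ1, Complex.sub_re]
    simp
  rw [hshift]
  have h := minEnergyOn_le_rayleigh_of_mem hHc (szSector (2 * n) 0) hψV hψ1
  linarith

/-- **Sector weight bound for the seeded torus.** For `β ≥ 0`, `n ≤ L²` and the sector
`V = szSector 2n 0`: `Re tr (P_V e^{-βK_L(μ,g)}) ≤ dim V · exp (−β (E_V(U,g) − μ·2n))`, where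
`E_V(U,g) = minEnergyOn H_L(U,g) V` is the canonical sector energy of the seeded Hamiltonian.
[folklore] -/
theorem seeded_sectorWeight_le (U μ g : ℝ) {β : ℝ} (hβ : 0 ≤ β) {n : ℕ}
    (hn : n ≤ Fintype.card (FermionTorus 2 L)) :
    ((projMatrix ((szSector (Λ := FermionTorus 2 L) (2 * n) (0 : ℝ)).map
        ((WithLp.linearEquiv 2 ℂ (Finset (Orb (FermionTorus 2 L)) → ℂ)).symm :
          (Finset (Orb (FermionTorus 2 L)) → ℂ) →ₗ[ℂ]
            EuclideanSpace ℂ (Finset (Orb (FermionTorus 2 L))))) *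
      gibbsWeight β (hubbardTorusWith 2 L 1 U μ - ((g / (L : ℝ) ^ 2 : ℝ) : ℂ) •
        ((pairField dWaveFormFactor L)ᴴ * pairField dWaveFormFactor L))).trace).re ≤
      (Module.finrank ℂ (szSector (Λ := FermionTorus 2 L) (2 * n) (0 : ℝ)) : ℝ) *
        Real.exp (-(β * ((hubbardTorus 2 L 1 U - ((g / (L : ℝ) ^ 2 : ℝ) : ℂ) •
          ((pairField dWaveFormFactor L)ᴴ * pairField dWaveFormFactor L)).minEnergyOn
            (szSector (Λ := FermionTorus 2 L) (2 * n) 0) - μ * ((2 * n : ℕ) : ℝ)))) := by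
  have h1 := re_trace_projMatrix_mul_gibbsWeight_le (tw_isHermitian_seededGC L U μ g)
    (szSector (Λ := FermionTorus 2 L) (2 * n) (0 : ℝ)) (tw_seededGC_mulVec_mem_szSector L U μ g n) hβ
  refine h1.trans (mul_le_mul_of_nonneg_left (Real.exp_le_exp.2 ?_) (Nat.cast_nonneg _))
  have h2 := tw_minEnergyOn_seededGC_ge L U μ g hn
  nlinarith

/-- **Probabilistic normal form of the ensemble defect.** For `β > 0`, `n ≤ L²`, the sector
`V = szSector 2n 0`, the seeded grand-canonical Hamiltonian `K = K_L(μ,g)` with partition function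
`Z = tr e^{-βK}` and sector weight `W_V = Re tr (P_V e^{-βK}) > 0`:
`β (E_V(U,g) − μ·2n) + log Re Z ≤ log dim V + log (Re Z / W_V)`,
i.e. `βL² · [E_V/L² + p_L(β,μ,U,g) − μ·2n/L²] ≤ log dim V + log (1 / w_V)` with `w_V = W_V / Re Z`
the Gibbs weight of the sector. (Any thermal bound on the defect is a lower bound on `w_V`.)
[folklore] -/
theorem seeded_defect_le_log_sectorWeight (U μ g : ℝ) {β : ℝ} (hβ : 0 < β) {n : ℕ}
    (hn : n ≤ Fintype.card (FermionTorus 2 L)) :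
    β * ((hubbardTorus 2 L 1 U - ((g / (L : ℝ) ^ 2 : ℝ) : ℂ) •
          ((pairField dWaveFormFactor L)ᴴ * pairField dWaveFormFactor L)).minEnergyOn
            (szSector (Λ := FermionTorus 2 L) (2 * n) 0) - μ * ((2 * n : ℕ) : ℝ)) +
        Real.log (partitionFn β (hubbardTorusWith 2 L 1 U μ - ((g / (L : ℝ) ^ 2 : ℝ) : ℂ) •
          ((pairField dWaveFormFactor L)ᴴ * pairField dWaveFormFactor L))).re ≤
      Real.log (Module.finrank ℂ (szSector (Λ := FermionTorus 2 L) (2 * n) (0 : ℝ)) : ℝ) +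
        Real.log ((partitionFn β (hubbardTorusWith 2 L 1 U μ - ((g / (L : ℝ) ^ 2 : ℝ) : ℂ) •
          ((pairField dWaveFormFactor L)ᴴ * pairField dWaveFormFactor L))).re /
          ((projMatrix ((szSector (Λ := FermionTorus 2 L) (2 * n) (0 : ℝ)).map
            ((WithLp.linearEquiv 2 ℂ (Finset (Orb (FermionTorus 2 L)) → ℂ)).symm :
              (Finset (Orb (FermionTorus 2 L)) → ℂ) →ₗ[ℂ]
                EuclideanSpace ℂ (Finset (Orb (FermionTorus 2 L))))) *
            gibbsWeight β (hubbardTorusWith 2 L 1 U μ - ((g / (L : ℝ) ^ 2 : ℝ) : ℂ) •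
              ((pairField dWaveFormFactor L)ᴴ * pairField dWaveFormFactor L))).trace).re) := by
  have hKh := tw_isHermitian_seededGC L U μ g
  have hinv := tw_seededGC_mulVec_mem_szSector L U μ g n
  -- `V ≠ ⊥`
  obtain ⟨ψ₀, -, hgs₀⟩ := exists_unit_groundState U g L hn
  have hVne : szSector (Λ := FermionTorus 2 L) (2 * n) (0 : ℝ) ≠ ⊥ := by
    intro h
    have hmem := hgs₀.1
    rw [h, Submodule.mem_bot] at hmem
    exact hgs₀.2.1 hmem
  have hdim : (0 : ℝ) < (Module.finrank ℂ (szSector (Λ := FermionTorus 2 L) (2 * n) (0 : ℝ)) : ℝ) :=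
    Nat.cast_pos.mpr (Submodule.one_le_finrank_iff.mpr hVne)
  have hW := re_trace_projMatrix_mul_gibbsWeight_pos hKh _ hinv hVne β
  have hZ : 0 < (partitionFn β (hubbardTorusWith 2 L 1 U μ - ((g / (L : ℝ) ^ 2 : ℝ) : ℂ) •
      ((pairField dWaveFormFactor L)ᴴ * pairField dWaveFormFactor L))).re :=
    lt_of_lt_of_le (Real.exp_pos _) (exp_neg_mul_groundEnergy_le_partitionFn hKh β)
  have hle := seeded_sectorWeight_le L U μ g hβ.le hn
  have hlog := Real.log_le_log hW hle
  rw [Real.log_mul hdim.ne' (Real.exp_pos _).ne', Real.log_exp] at hlog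
  rw [Real.log_div hZ.ne' hW.ne']
  linarith

end Seeded

end

end Summit.HubbardSuperconductivity.HubbardSuperconductivity.Theorems
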